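import Mathlib

/-!
# `Balaban1983to89.B9Eq342GradientRowComparisonMass` — T. Bałaban, *Propagators for lattice gauge theories in a background field*, Commun. Math. Phys. **99**
# (1985) 389–434 [Balaban1985BackgroundPropagators] Thm 3.1 (3.42) p. 397 (second entry, the covariant-gradient row) with [Balaban1984PropagatorsI] (1.29) p. 23
# (the free resolvent): **THE θ-SLOT OF THE GRADIENT-ROW BOOTSTRAP CLOSED BY THE COMPARISON MASS ALONE, IN THE CURRENCY OF THE FLAT (K∇) LETTER
# `B5Eq129FreeResolventGradientRow` — `S_C(m,t) := |t|·2∕√(m² + 4mt²) ≤ m^{−1∕2}` for EVERY `t` (every lattice spacing `η = t⁻¹`), so `2ε₁ ≤ √m` gives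
# `S_C·ε₁ ≤ 1∕2 < 1` (the `hθ` binder of `B9Eq342GradientRowBootstrap.norm_le_of_gradient_response_bootstrap`, window-free in the background letter `ε₁`),
# and the bootstrap's closed form then reads `‖D b‖ ≤ (2(Γ + ε₂N)∕√m + 2ε₀N)·w′ b`**

statement-level skeleton of published theorems with citation tags; proofs where landed; nothing here is a claim about the Yang–Mills mass gap

CITATION HEADER (lean-in-tree rule).  Audit cell `pub-balaban`, sub-cell `t4`, BINDER row NE9; filed by NE9 crux-team LEAF PROVER 05
(`b2b-balaban-t4-ne9-formalise-leaf-05`, gen 83).  MATHEMATICS AND LEAN: t4-ne9-idea-1 (NE9 crux ideation lens 1), gen 143, content note N44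
`t4/ideate/NE9/lens1-g143/N44-GRADROW-THETA-SLOT-g143.md` (v1 c7f56973fbf1c4e4, v2 5fe7ec18a2002f25) and scratch kernel E
`t4/ideate/NE9/lens1-g143/lean/NE9GradRowClosing.lean` (v1 71aaa56337496beb §0∕§θ; v2 35502169ea5640fe §W): `abs_mul_row_le_inv_sqrt`,
`theta_le_half_of_comparison_mass`, `theta_lt_one_of_comparison_mass`, `output_le_of_comparison_mass`, `mul_weighted_row_le` (farm rc 0, axioms trio) — PORTED
VERBATIM (the five lemma bodies byte-for-byte), CREDIT THEIRS; offered for adoption in their W-g143-5 ∕ A-1 (journal 2026-08-24T19:19:48Z) and L-g143-4 (19:28:14Z).  The mechanism («the comparison mass is free and large») is that lineage's N17 S6 ∕ N22 ∕ P-J-3 `mass_choice`.  SOURCE loci: [B9] p. 397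
Thm 3.1 (3.42); [B5′] p. 23 (1.29) — cites only; [folklore] real arithmetic; nothing printed is a hypothesis.

WHY THIS FILE (cell context).  `B9Eq342GradientRowBootstrap` (storey J's (N) step) carries the contraction binder `hθ : S·ε₁ < 1` (the desk's (d1) «NEEDS-CONSTANT»
on row L13).  In the UNWEIGHTED currency the (K∇) letter (C) `B5Eq129FreeResolventGradientRow.norm_apply_sub_le_of_resolvent` (p384298 ✓) has
`S = S_C(m,t) = |t|·2∕√(m² + 4mt²)`; this file shows `S_C ≤ m^{−1∕2}` and hence that `hθ` is met by the CHOICE `m ≥ 4ε₁²` of the comparison mass, with no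
smallness of `ε₁ = 2c_χ∕r + 2d·a`; the price is the `√m` in the data slot (`Γ = Γ(m)`), said in `output_le_of_comparison_mass`.  §3 is the WEIGHTED
companion for (K24)'s constant under a κ-window relative to `m` (the decay currency's row gain); whether that closes the desk's (d1) for the row of record is the
desk's ∕ OWNER's reading, not asserted here.

WHAT IS PROVED (sorry-free; 0 `def`; `import Mathlib` only; [folklore]).
* **`abs_mul_row_le_inv_sqrt`** — `|t|·(2∕√(m² + 4mt²)) ≤ (√m)⁻¹` (`m > 0`, every real `t`).
* **`theta_le_half_of_comparison_mass`** ∕ **`theta_lt_one_of_comparison_mass`** — `0 ≤ ε₁`, `2ε₁ ≤ √m` ⟹ `S_C·ε₁ ≤ 1∕2` (`< 1`).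
* **`output_le_of_comparison_mass`** — `B9Eq342GradientRowBootstrap.norm_le_of_gradient_response_bootstrap`'s CONCLUSION entered verbatim as `hD` with `S := S_C`
  (letters `ε₀ ε₁ ε₂ Γ N w′` exactly that file's; `0 ≤ ε₀·N`) ⟹ `‖D b‖ ≤ (2(Γ + ε₂N)∕√m + 2(ε₀N))·w′ b`.
* §3 **`mul_weighted_row_le`** — THE WEIGHTED COMPANION: the direction constant `B_ν` of `B5Eq129FreeResolventWeightedGradientRowOperator.norm_apply_sub_le_of_resolvent_weighted`
  (product-`cosh` currency, rate `a ≥ 0`, `n = N_ν > 0`, `t > 0`) satisfies, under the κ-window RELATIVE TO THE MASS `4d·t²(cosh a − 1) ≤ m`,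
  `t·B_ν ≤ (1 + e^{−a})(1 + 2t∕(n√(m∕2)))∕(2√(m∕2)) + 4t·sinh a∕m` — the `m^{−1∕2}` gain survives the weight.
HONEST SCOPE.  Real arithmetic; no lattice object; the junction with (C) ∕ the pure-gauge response map (`B9Eq331PureGaugeResolventConjugation` §4,
`B9Eq331PureGaugeResolventLetters`) is one application each and is left to the consumer (their oleans are unbuilt at filing); nothing of Bałaban's asserted,
valued or discharged.  NOT summit progress (cell pub-balaban: NE9 NOT PRINTED ∕ NOT PROVED; «NE9 ⇐ the named binders»; row WALLED ON A MODEL (O-NE9-1; #5 UNRULED);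
spine PROVED 0∕9; rung (B)+1 finite T⁴ — NOT infinite volume, NOT mass gap, NOT BetaPertH, NOT Clay).  HONEST DEPENDENCY (cell line): continuum YM on T⁴ ⇐ BetaPertH ∧
nine spine estimates (0/9 proved); BetaPertH ⇐ (D1) ∧ (D4) ∧ CAP+tail; G-an2-4 gates asym, D1 and NE2/3/4.  NEW file importing Mathlib only; nothing modified.  Net
new unproved facts: 0.
-/

namespace Literature.MathematicalPhysics.QuantumFieldTheory.Balaban1983to89.B9Eq342GradientRowComparisonMass

/-! ## §1 The comparison-mass gain of (C)'s closed form -/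

/-- `|t|·(2∕√(m² + 4mt²)) ≤ (√m)⁻¹` for `m > 0`: `(2|t|√m)² = 4t²m ≤ m² + 4mt²`.  At `t = η⁻¹`: `η⁻¹·(2∕√(m² + 4mη⁻²)) = 2∕√(m²η² + 4m) ≤ 1∕√m`
uniformly in `η` ((C) `inv_eta_mul_sum_abs_green_sub_le`'s right-hand side). [folklore]
[cite: Balaban1985BackgroundPropagators, Thm 3.1 (3.42) p.397; Balaban1984PropagatorsI, (1.29) p.23] -/
theorem abs_mul_row_le_inv_sqrt (t : ℝ) {m : ℝ} (hm : 0 < m) :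
    |t| * (2 / Real.sqrt (m ^ 2 + 4 * m * t ^ 2)) ≤ (Real.sqrt m)⁻¹ := by
  have hS : 0 < Real.sqrt (m ^ 2 + 4 * m * t ^ 2) := Real.sqrt_pos.2 (by positivity)
  have hsm : 0 < Real.sqrt m := Real.sqrt_pos.2 hm
  have h1 : (2 * |t| * Real.sqrt m) ^ 2 ≤ m ^ 2 + 4 * m * t ^ 2 := by
    rw [mul_pow, mul_pow, sq_abs, Real.sq_sqrt hm.le]; nlinarith [sq_nonneg m]
  have h2 : 2 * |t| * Real.sqrt m ≤ Real.sqrt (m ^ 2 + 4 * m * t ^ 2) := by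
    have h := Real.abs_le_sqrt h1
    rwa [abs_of_nonneg (by positivity)] at h
  rw [show |t| * (2 / Real.sqrt (m ^ 2 + 4 * m * t ^ 2)) = (2 * |t|) / Real.sqrt (m ^ 2 + 4 * m * t ^ 2) by ring,
    div_le_iff₀ hS, ← one_div, one_div_mul_eq_div, le_div_iff₀ hsm]
  exact h2

/-! ## §2 The θ-slot of row L13 in (C)'s currency: met by the comparison mass, window-free in `ε₁` -/

/-- **THE θ-SLOT BY THE COMPARISON MASS.**  With the (C)-currency row letter `S_C(m,t) := |t|·2∕√(m² + 4mt²)` in the θ-slot of the TREE's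
`B9Eq342GradientRowBootstrap.norm_le_of_gradient_response_bootstrap` (`hθ : S·ε₁ < 1`; dictionary there: `ε₁ = 2c_χ∕r + 2d·a`), the choice
`2ε₁ ≤ √m` gives `S_C·ε₁ ≤ 1∕2` — for EVERY `t` (every lattice spacing `η = t⁻¹`), with NO smallness of `ε₁`: the comparison mass absorbs the
background letter (lineage: N17 S6, P-J-3 `mass_choice`; here transcribed into (C)'s mass, where the row gain is `m^{−1∕2}`). [folklore]
[cite: Balaban1985BackgroundPropagators, Thm 3.1 (3.42) p.397; Balaban1984PropagatorsI, (1.29) p.23] -/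
theorem theta_le_half_of_comparison_mass (t : ℝ) {m ε₁ : ℝ} (hm : 0 < m) (hε₁ : 0 ≤ ε₁) (hmε : 2 * ε₁ ≤ Real.sqrt m) :
    |t| * (2 / Real.sqrt (m ^ 2 + 4 * m * t ^ 2)) * ε₁ ≤ 1 / 2 := by
  have hsm : 0 < Real.sqrt m := Real.sqrt_pos.2 hm
  have hS := abs_mul_row_le_inv_sqrt t hm
  have hS0 : 0 ≤ |t| * (2 / Real.sqrt (m ^ 2 + 4 * m * t ^ 2)) := by positivity
  calc |t| * (2 / Real.sqrt (m ^ 2 + 4 * m * t ^ 2)) * ε₁ ≤ (Real.sqrt m)⁻¹ * ε₁ := mul_le_mul_of_nonneg_right hS hε₁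
    _ ≤ (Real.sqrt m)⁻¹ * (Real.sqrt m / 2) := mul_le_mul_of_nonneg_left (by linarith) (inv_nonneg.2 hsm.le)
    _ = 1 / 2 := by rw [← mul_div_assoc, inv_mul_cancel₀ hsm.ne']

/-- The strict form the TREE's `hθ` binder wants: `S_C·ε₁ < 1`. [folklore]
[cite: Balaban1985BackgroundPropagators, Thm 3.1 (3.42) p.397; Balaban1984PropagatorsI, (1.29) p.23] -/
theorem theta_lt_one_of_comparison_mass (t : ℝ) {m ε₁ : ℝ} (hm : 0 < m) (hε₁ : 0 ≤ ε₁) (hmε : 2 * ε₁ ≤ Real.sqrt m) :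
    |t| * (2 / Real.sqrt (m ^ 2 + 4 * m * t ^ 2)) * ε₁ < 1 :=
  (theta_le_half_of_comparison_mass t hm hε₁ hmε).trans_lt (by norm_num)

/-- **THE OUTPUT CONSTANT AFTER THE MASS CHOICE.**  The TREE's closed form `‖D b‖ ≤ (S·(Γ + ε₂N) + ε₀N)∕(1 − S·ε₁)·w′ b` (conclusion of
`norm_le_of_gradient_response_bootstrap`, entered VERBATIM as `hD`) with `S = S_C(m,t)` and `2ε₁ ≤ √m` reads
`‖D b‖ ≤ (2(Γ + ε₂N)∕√m + 2ε₀N)·w′ b` — the price of the free mass is the factor `2` and the `√m` hidden in `Γ` (the comparison-mass shift `(m − ·)u`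
feeds storey (D)'s value row `N` into the data slot; dictionary of the TREE file). [folklore]
[cite: Balaban1985BackgroundPropagators, Thm 3.1 (3.42) p.397; Balaban1984PropagatorsI, (1.29) p.23] -/
theorem output_le_of_comparison_mass {Y E : Type*} [SeminormedAddCommGroup E] (D : Y → E) (w' : Y → ℝ) (hw' : ∀ b, 0 < w' b)
    (t : ℝ) {m ε₀ ε₁ ε₂ Γ N : ℝ} (hm : 0 < m) (hε₁ : 0 ≤ ε₁) (hε₂ : 0 ≤ ε₂) (hΓ : 0 ≤ Γ) (hN : 0 ≤ N) (hε₀N : 0 ≤ ε₀ * N)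
    (hmε : 2 * ε₁ ≤ Real.sqrt m)
    (hD : ∀ b, ‖D b‖ ≤ (|t| * (2 / Real.sqrt (m ^ 2 + 4 * m * t ^ 2)) * (Γ + ε₂ * N) + ε₀ * N) /
      (1 - |t| * (2 / Real.sqrt (m ^ 2 + 4 * m * t ^ 2)) * ε₁) * w' b) (b : Y) :
    ‖D b‖ ≤ (2 * (Γ + ε₂ * N) / Real.sqrt m + 2 * (ε₀ * N)) * w' b := by
  have hsm : 0 < Real.sqrt m := Real.sqrt_pos.2 hm
  set S := |t| * (2 / Real.sqrt (m ^ 2 + 4 * m * t ^ 2)) with hSdef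
  have hS0 : 0 ≤ S := by rw [hSdef]; positivity
  have hSle : S ≤ (Real.sqrt m)⁻¹ := abs_mul_row_le_inv_sqrt t hm
  have hθ : S * ε₁ ≤ 1 / 2 := theta_le_half_of_comparison_mass t hm hε₁ hmε
  have hden : 1 / 2 ≤ 1 - S * ε₁ := by linarith
  have hdenpos : 0 < 1 - S * ε₁ := by linarith
  have hnum0 : 0 ≤ S * (Γ + ε₂ * N) + ε₀ * N := by positivity
  refine (hD b).trans (mul_le_mul_of_nonneg_right ?_ (hw' b).le)
  rw [div_le_iff₀ hdenpos]
  have hG : 0 ≤ Γ + ε₂ * N := by positivity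
  have h1 : S * (Γ + ε₂ * N) ≤ (Real.sqrt m)⁻¹ * (Γ + ε₂ * N) := mul_le_mul_of_nonneg_right hSle hG
  have h2 : (Real.sqrt m)⁻¹ * (Γ + ε₂ * N) = (Γ + ε₂ * N) / Real.sqrt m := by rw [inv_mul_eq_div]
  have hR0 : 0 ≤ 2 * (Γ + ε₂ * N) / Real.sqrt m + 2 * (ε₀ * N) := by positivity
  have key : S * (Γ + ε₂ * N) + ε₀ * N ≤ (2 * (Γ + ε₂ * N) / Real.sqrt m + 2 * (ε₀ * N)) * (1 / 2) := by
    rw [h2] at h1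
    have e : (2 * (Γ + ε₂ * N) / Real.sqrt m + 2 * (ε₀ * N)) * (1 / 2) = (Γ + ε₂ * N) / Real.sqrt m + ε₀ * N := by ring
    rw [e]
    linarith
  exact key.trans (mul_le_mul_of_nonneg_left hden hR0)

/-! ## §3 The weighted θ-slot: (K24)'s direction constant keeps the `m^{−1∕2}` gain under a κ-window relative to `m` (kernel E v2 §W) -/

/-- **THE WEIGHTED ROW GAIN.**  (K24) `B5Eq129FreeResolventWeightedGradientRowOperator.norm_apply_sub_le_of_resolvent_weighted` (ne9-leaf-05 g81, v1.2
5b36808e52e6afdb, STAGED) has, in the product-`cosh` currency with per-site rate `a ≥ 0` (`a = κη` for a physical rate `κ`), the direction constant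
`B_ν = (1 + e^{−a})·(1 + 2t∕(N_ν√m₁))∕√(m₁² + 4m₁t²) + 2 sinh a∕m₀`, `m₁ = m − 2(d−1)t²(cosh a − 1)`, `m₀ = m − 2d·t²(cosh a − 1)` (its `hlam : m₀ > 0`).
Under the κ-WINDOW RELATIVE TO THE MASS `4d·t²(cosh a − 1) ≤ m` (for `a = κ∕t`: `≈ 2dκ² ≤ m`, NO window on `η`) the `|t|`-normalised letter keeps the gain:
`t·B_ν ≤ (1 + e^{−a})(1 + 2t∕(N_ν√(m∕2)))∕(2√(m∕2)) + 4t·sinh a∕m` — first term `O(m^{−1∕2})` by §0 at `m₁ ≥ m∕2`, second `O(κ∕m)` since `t·sinh(κ∕t) ≤ κ·cosh κ`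
for `t ≥ 1`.  So the weighted θ-slot `t·B_ν·ε₁ < 1` of `B9Eq342GradientRowPureGauge` §3 (`S = |t|`, `w′ b = B_{b.2}·W(b₊)`, read with `ε₁` in the natural sup
currency) is again met by the comparison mass, polynomially in `ε₁` and `κ`. (`n` stands for `(N ν : ℝ)`.) (t4-ne9-idea-1 g143 kernel E v2 §W, verbatim.) [folklore]
[cite: Balaban1985BackgroundPropagators, Thm 3.1 (3.42) p.397; Balaban1984PropagatorsI, (1.29) p.23] -/
theorem mul_weighted_row_le (t : ℝ) (ht : 0 < t) {m a n : ℝ} (hm : 0 < m) (ha : 0 ≤ a) (hn : 0 < n) (d : ℕ)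
    (hwin : 4 * (d : ℝ) * (t ^ 2 * (Real.cosh a - 1)) ≤ m) :
    t * ((1 + Real.exp (-a)) * ((1 + 2 * t / (n * Real.sqrt (m - 2 * ((d : ℝ) - 1) * t ^ 2 * (Real.cosh a - 1)))) /
            Real.sqrt ((m - 2 * ((d : ℝ) - 1) * t ^ 2 * (Real.cosh a - 1)) ^ 2 +
              4 * (m - 2 * ((d : ℝ) - 1) * t ^ 2 * (Real.cosh a - 1)) * t ^ 2)) +
          2 * Real.sinh a / (m - 2 * (d : ℝ) * t ^ 2 * (Real.cosh a - 1)))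
      ≤ (1 + Real.exp (-a)) * (1 + 2 * t / (n * Real.sqrt (m / 2))) / (2 * Real.sqrt (m / 2)) + 4 * t * Real.sinh a / m := by
  -- letters
  set X := t ^ 2 * (Real.cosh a - 1) with hXdef
  have hX0 : 0 ≤ X := by rw [hXdef]; exact mul_nonneg (sq_nonneg _) (sub_nonneg.2 (Real.one_le_cosh a))
  set m₁ := m - 2 * ((d : ℝ) - 1) * t ^ 2 * (Real.cosh a - 1) with hm₁def
  set m₀ := m - 2 * (d : ℝ) * t ^ 2 * (Real.cosh a - 1) with hm₀def
  have hm₀X : m₀ = m - 2 * (d : ℝ) * X := by rw [hm₀def, hXdef]; ring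
  have hm₁X : m₁ = m - 2 * (d : ℝ) * X + 2 * X := by rw [hm₁def, hXdef]; ring
  have hm₀ : m / 2 ≤ m₀ := by rw [hm₀X]; linarith
  have hm₁ : m / 2 ≤ m₁ := by rw [hm₁X]; linarith
  have hm2 : 0 < m / 2 := by linarith
  have hm₀pos : 0 < m₀ := hm2.trans_le hm₀
  have hm₁pos : 0 < m₁ := hm2.trans_le hm₁
  have hP : 0 ≤ 1 + Real.exp (-a) := by positivity
  have hsq2 : 0 < Real.sqrt (m / 2) := Real.sqrt_pos.2 hm2
  have hsq₁ : Real.sqrt (m / 2) ≤ Real.sqrt m₁ := Real.sqrt_le_sqrt hm₁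
  have hsq₁pos : 0 < Real.sqrt m₁ := Real.sqrt_pos.2 hm₁pos
  -- the second term: `2 sinh a ∕ m₀ ≤ 4 sinh a ∕ m`
  have hsinh : 0 ≤ Real.sinh a := Real.sinh_nonneg_iff.2 ha
  have hT2 : t * (2 * Real.sinh a / m₀) ≤ 4 * t * Real.sinh a / m := by
    have h1 : 2 * Real.sinh a / m₀ ≤ 2 * Real.sinh a / (m / 2) := div_le_div_of_nonneg_left (by positivity) hm2 hm₀
    calc t * (2 * Real.sinh a / m₀) ≤ t * (2 * Real.sinh a / (m / 2)) := mul_le_mul_of_nonneg_left h1 ht.le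
      _ = 4 * t * Real.sinh a / m := by field_simp; ring
  -- the first term: §0 at `m₁`, then monotonicity in `m₁ ≥ m∕2`
  have hR : t * (1 / Real.sqrt (m₁ ^ 2 + 4 * m₁ * t ^ 2)) ≤ 1 / (2 * Real.sqrt m₁) := by
    have h := abs_mul_row_le_inv_sqrt t hm₁pos
    rw [abs_of_pos ht] at h
    have e : t * (1 / Real.sqrt (m₁ ^ 2 + 4 * m₁ * t ^ 2)) = (t * (2 / Real.sqrt (m₁ ^ 2 + 4 * m₁ * t ^ 2))) / 2 := by ring
    rw [e, div_le_iff₀ (by norm_num : (0:ℝ) < 2)]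
    calc t * (2 / Real.sqrt (m₁ ^ 2 + 4 * m₁ * t ^ 2)) ≤ (Real.sqrt m₁)⁻¹ := h
      _ = 1 / (2 * Real.sqrt m₁) * 2 := by field_simp
  have hR' : 1 / (2 * Real.sqrt m₁) ≤ 1 / (2 * Real.sqrt (m / 2)) :=
    div_le_div_of_nonneg_left zero_le_one (by positivity) (by linarith)
  have hQ₁0 : 0 ≤ 1 + 2 * t / (n * Real.sqrt m₁) := by positivity
  have hQ : 1 + 2 * t / (n * Real.sqrt m₁) ≤ 1 + 2 * t / (n * Real.sqrt (m / 2)) := by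
    have : 2 * t / (n * Real.sqrt m₁) ≤ 2 * t / (n * Real.sqrt (m / 2)) :=
      div_le_div_of_nonneg_left (by positivity) (by positivity) (mul_le_mul_of_nonneg_left hsq₁ hn.le)
    linarith
  have hT1 : t * ((1 + Real.exp (-a)) * ((1 + 2 * t / (n * Real.sqrt m₁)) / Real.sqrt (m₁ ^ 2 + 4 * m₁ * t ^ 2)))
      ≤ (1 + Real.exp (-a)) * (1 + 2 * t / (n * Real.sqrt (m / 2))) / (2 * Real.sqrt (m / 2)) := by
    have e : t * ((1 + Real.exp (-a)) * ((1 + 2 * t / (n * Real.sqrt m₁)) / Real.sqrt (m₁ ^ 2 + 4 * m₁ * t ^ 2)))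
        = ((1 + Real.exp (-a)) * (1 + 2 * t / (n * Real.sqrt m₁))) * (t * (1 / Real.sqrt (m₁ ^ 2 + 4 * m₁ * t ^ 2))) := by ring
    rw [e]
    have hPQ : 0 ≤ (1 + Real.exp (-a)) * (1 + 2 * t / (n * Real.sqrt m₁)) := mul_nonneg hP hQ₁0
    calc ((1 + Real.exp (-a)) * (1 + 2 * t / (n * Real.sqrt m₁))) * (t * (1 / Real.sqrt (m₁ ^ 2 + 4 * m₁ * t ^ 2)))
        ≤ ((1 + Real.exp (-a)) * (1 + 2 * t / (n * Real.sqrt m₁))) * (1 / (2 * Real.sqrt (m / 2))) :=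
          mul_le_mul_of_nonneg_left (hR.trans hR') hPQ
      _ ≤ ((1 + Real.exp (-a)) * (1 + 2 * t / (n * Real.sqrt (m / 2)))) * (1 / (2 * Real.sqrt (m / 2))) :=
          mul_le_mul_of_nonneg_right (mul_le_mul_of_nonneg_left hQ hP) (by positivity)
      _ = (1 + Real.exp (-a)) * (1 + 2 * t / (n * Real.sqrt (m / 2))) / (2 * Real.sqrt (m / 2)) := by ring
  -- assemble
  calc t * ((1 + Real.exp (-a)) * ((1 + 2 * t / (n * Real.sqrt m₁)) / Real.sqrt (m₁ ^ 2 + 4 * m₁ * t ^ 2)) + 2 * Real.sinh a / m₀)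
      = t * ((1 + Real.exp (-a)) * ((1 + 2 * t / (n * Real.sqrt m₁)) / Real.sqrt (m₁ ^ 2 + 4 * m₁ * t ^ 2))) + t * (2 * Real.sinh a / m₀) := by
        ring
    _ ≤ _ := add_le_add hT1 hT2

end Literature.MathematicalPhysics.QuantumFieldTheory.Balaban1983to89.B9Eq342GradientRowComparisonMass
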